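import Literature.NumberTheory.Sieve.SmoothCountGaussPerron
import HarnessLib

/-!
# Gaussian-weighted short-interval sums of smooth numbers by Plancherel

Topic `Literature/NumberTheory/Sieve`; a PROVED tool file, sequel of `SmoothCountGaussPerron`. The error term of
the Gaussian-smoothed Perron formula `card_smooth_gaussPerron` is the short-interval sum
`E = Σ_{n y-smooth} n^{-α} e^{-T²(log n - log x)²/8}`. Writing the Gaussian as the Fourier integral of its
own (Gaussian) weight, `e^{-T²w²/8} = (2√(2π)/T) k_{T/2}(w) = (2√(2π)/T) ∫ e^{-8π²ξ²/T²} e^{-2πiξw} dξ`, and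
interchanging with the sum over `n` (dominated convergence, as in `hasSum_indicator_conv`) gives the EXACT identity

* `hasSum_indicator_perronGauss` — `Σ_{n y-smooth} n^{-α} k_T(log n - log x) = ∫ e^{-2π²ξ²/T²} x^{2πiξ} ζ(α + 2πiξ, y) dξ`,

whence (`tsum_indicator_exp_neg_le`) `E ≤ (2√(2π)/T) ∫ e^{-8π²ξ²/T²} |ζ(α + 2πiξ, y)| dξ` and the form of the
smoothed Perron formula used later,

* `card_smooth_gaussPerron_integral` — for `x ≥ 1`, `0 < α ≤ T/2`:
  `|x^{-α} Ψ(x, y) - e^{-α²/(2T²)} Re ∫ e^{-2π²ξ²/T²} x^{2πiξ} ζ(α + 2πiξ, y)/(α + 2πiξ) dξ|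
     ≤ (4√(2π)/T) ∫ e^{-8π²ξ²/T²} |ζ(α + 2πiξ, y)| dξ`.

This replaces Hildebrand–Tenenbaum's Lemma 9 (short intervals, proved there from Theorem 1's machinery at height
`Y(ε)`) by a bound in which only `|ζ(α + iτ, y)|` against a Gaussian of width `T` enters — an Esseen-type
smoothing inequality with the Gaussian as its own band-limiting kernel. [cite: HildebrandTenenbaum1986, Lemma 9 (proof,
"bilateral Laplace transform")]

## References

* [HildebrandTenenbaum1986] A. Hildebrand, G. Tenenbaum, Trans. AMS 296 (1986) 265–290, §4, Lemma 9 (held: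
  `paper:doi-10-1090-s0002-9947-1986-0837811-1`, p. 277).
-/

noncomputable section

open Complex MeasureTheory Real Set Filter
open scoped FourierTransform Topology

namespace Literature.NumberTheory.Sieve

namespace GaussPerron

variable {α T x : ℝ} {y n : ℕ}

/-- `k_T(w) = ∫ e^{-2π²ξ²/T²} e^{-2πiξw} dξ` (`𝓕 G_T = k_T` evaluated at `w`). [folklore] -/
theorem perronGauss_eq_integral (hT : 0 < T) (w : ℝ) :
    ((perronGauss T w : ℝ) : ℂ) = ∫ ξ : ℝ, perronDamping T ξ * cexp (-((2 * Real.pi * ξ * w : ℝ) : ℂ) * I) := by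
  have h := congrFun (fourier_perronDamping hT) w
  rw [← h, Real.fourier_real_eq_integral_exp_smul]
  refine integral_congr_ae (Eventually.of_forall fun ξ => ?_)
  simp only [smul_eq_mul]
  rw [mul_comm]
  congr 2
  push_cast
  ring

/-- `e^{-T²w²/8} = (2√(2π)/T) k_{T/2}(w)`. [folklore] -/
theorem exp_neg_eq_mul_perronGauss_half (hT : 0 < T) (w : ℝ) :
    Real.exp (-(T ^ 2 * w ^ 2 / 8)) = 2 * Real.sqrt (2 * Real.pi) / T * perronGauss (T / 2) w := by
  unfold perronGauss
  have hs : 0 < Real.sqrt (2 * Real.pi) := Real.sqrt_pos.2 (by positivity)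
  rw [show (T / 2) ^ 2 * w ^ 2 / 2 = T ^ 2 * w ^ 2 / 8 by ring]
  field_simp

/-- **`Σ_{n y-smooth} n^{-α} k_T(log n - log x) = ∫ e^{-2π²ξ²/T²} x^{2πiξ} ζ(α + 2πiξ, y) dξ`** (`α, T, x > 0`):
Plancherel for the measure `Σ_{n y-smooth} n^{-α} δ_{log n}` against the Gaussian `k_T` (the `n`-sum and the
`ξ`-integral interchanged by dominated convergence, dominant `ζ(α, y) e^{-2π²ξ²/T²}`).
[cite: HildebrandTenenbaum1986, Lemma 9 (proof)] -/
theorem hasSum_indicator_perronGauss (hα : 0 < α) (hT : 0 < T) (hx : 0 < x) (y : ℕ) :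
    HasSum (fun n : ℕ => (((Nat.smoothNumbers (y + 1)).indicator
        (fun n : ℕ => (n : ℝ) ^ (-α) * perronGauss T (Real.log n - Real.log x)) n : ℝ) : ℂ))
      (∫ ξ : ℝ, perronDamping T ξ * ((x : ℂ) ^ (2 * Real.pi * ξ * I) *
        smoothZetaC ((α : ℂ) + 2 * Real.pi * ξ * I) y)) := by
  set F : ℕ → ℝ → ℂ := fun n ξ => (Nat.smoothNumbers (y + 1)).indicator (fun n : ℕ =>
    (((n : ℝ) ^ (-α) : ℝ) : ℂ) * (perronDamping T ξ *
      cexp (-((2 * Real.pi * ξ * (Real.log n - Real.log x) : ℝ) : ℂ) * I))) n with hF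
  set D : ℝ → ℝ := fun ξ => ‖perronDamping T ξ‖ with hD
  have hDint : Integrable D := (integrable_perronDamping hT).norm
  have hFnorm : ∀ n : ℕ, ∀ ξ : ℝ, ‖F n ξ‖ =
      (Nat.smoothNumbers (y + 1)).indicator (fun n : ℕ => (n : ℝ) ^ (-α)) n * D ξ := by
    intro n ξ
    simp only [hF, hD]
    by_cases hn : n ∈ Nat.smoothNumbers (y + 1)
    · rw [indicator_of_mem hn, indicator_of_mem hn, norm_mul, norm_mul, Complex.norm_real,
        Real.norm_eq_abs, abs_of_nonneg (Real.rpow_nonneg (Nat.cast_nonneg n) _), ← Complex.ofReal_neg,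
        Complex.norm_exp_ofReal_mul_I, mul_one]
    · rw [indicator_of_notMem hn, indicator_of_notMem hn, norm_zero, zero_mul]
  have hFmeas : ∀ n : ℕ, AEStronglyMeasurable (F n) := by
    intro n
    simp only [hF]
    by_cases hn : n ∈ Nat.smoothNumbers (y + 1)
    · simp only [indicator_of_mem hn]
      refine Continuous.aestronglyMeasurable ?_
      exact continuous_const.mul ((continuous_perronDamping T).mul (by fun_prop))
    · simp only [indicator_of_notMem hn]
      exact aestronglyMeasurable_const
  have hFint : ∀ n : ℕ, Integrable (F n) := fun n =>
    (hDint.const_mul ((Nat.smoothNumbers (y + 1)).indicator (fun n : ℕ => (n : ℝ) ^ (-α)) n)).mono' (hFmeas n)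
      (Eventually.of_forall fun ξ => (hFnorm n ξ).le)
  have hsum : Summable fun n : ℕ => ∫ ξ : ℝ, ‖F n ξ‖ := by
    have : (fun n : ℕ => ∫ ξ : ℝ, ‖F n ξ‖) =
        fun n : ℕ => (Nat.smoothNumbers (y + 1)).indicator (fun n : ℕ => (n : ℝ) ^ (-α)) n * ∫ ξ : ℝ, D ξ := by
      funext n; simp_rw [hFnorm n]; exact integral_const_mul _ _
    rw [this]
    exact (hasSum_indicator_rpow_neg hα y).summable.mul_right _
  have hmain := hasSum_integral_of_summable_integral_norm hFint hsum
  -- the `n`-th integral is `n^{-α} k_T(log n - log x)`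
  have hleft : (fun n : ℕ => ∫ ξ : ℝ, F n ξ) = fun n : ℕ => (((Nat.smoothNumbers (y + 1)).indicator
      (fun n : ℕ => (n : ℝ) ^ (-α) * perronGauss T (Real.log n - Real.log x)) n : ℝ) : ℂ) := by
    funext n
    simp only [hF]
    by_cases hn : n ∈ Nat.smoothNumbers (y + 1)
    · simp only [indicator_of_mem hn]
      rw [integral_const_mul, ← perronGauss_eq_integral hT (Real.log n - Real.log x)]
      push_cast
      rfl
    · simp only [indicator_of_notMem hn, integral_zero, Complex.ofReal_zero]
  -- the sum under the integral is `G_T(ξ) x^{2πiξ} ζ(α + 2πiξ, y)`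
  have hpt : ∀ ξ : ℝ, HasSum (fun n : ℕ => F n ξ) (perronDamping T ξ * ((x : ℂ) ^ (2 * Real.pi * ξ * I) *
      smoothZetaC ((α : ℂ) + 2 * Real.pi * ξ * I) y)) := by
    intro ξ
    have hsre : 0 < ((α : ℂ) + 2 * Real.pi * ξ * I).re := by simp [hα]
    have hL := LSeriesHasSum_smoothIndicator hsre y
    rw [LSeriesHasSum, show LSeries.term (smoothIndicator y) ((α : ℂ) + 2 * Real.pi * ξ * I) =
      (Nat.smoothNumbers (y + 1)).indicator (fun m : ℕ => (m : ℂ) ^ (-((α : ℂ) + 2 * Real.pi * ξ * I))) from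
        funext (term_smoothIndicator y _)] at hL
    have hL2 := hL.mul_left (perronDamping T ξ * (x : ℂ) ^ (2 * Real.pi * ξ * I))
    have hfun : (fun n : ℕ => F n ξ) = fun n : ℕ =>
        perronDamping T ξ * (x : ℂ) ^ (2 * Real.pi * ξ * I) *
          (Nat.smoothNumbers (y + 1)).indicator
            (fun m : ℕ => (m : ℂ) ^ (-((α : ℂ) + 2 * Real.pi * ξ * I))) n := by
      funext n
      simp only [hF]
      by_cases hn : n ∈ Nat.smoothNumbers (y + 1)
      · rw [indicator_of_mem hn, indicator_of_mem hn]
        have hn0 : 0 < n := Nat.pos_of_ne_zero (Nat.ne_zero_of_mem_smoothNumbers hn)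
        have key := cpow_mul_natCast_cpow_neg hx hn0 α (2 * Real.pi * ξ)
        have hexp : cexp (-((2 * Real.pi * ξ * (Real.log n - Real.log x) : ℝ) : ℂ) * I) =
            cexp (-((2 * Real.pi * ξ : ℂ) * ((Real.log n : ℂ) - (Real.log x : ℂ)) * I)) := by
          congr 1; push_cast; ring
        rw [hexp, show perronDamping T ξ * (x : ℂ) ^ (2 * Real.pi * ξ * I) *
            (n : ℂ) ^ (-((α : ℂ) + 2 * Real.pi * ξ * I)) =
          perronDamping T ξ * ((x : ℂ) ^ ((2 * Real.pi * ξ : ℂ) * I) *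
            (n : ℂ) ^ (-((α : ℂ) + (2 * Real.pi * ξ : ℂ) * I))) by ring, key]
        ring
      · rw [indicator_of_notMem hn, indicator_of_notMem hn, mul_zero]
    rw [hfun, show perronDamping T ξ * ((x : ℂ) ^ (2 * Real.pi * ξ * I) *
        smoothZetaC ((α : ℂ) + 2 * Real.pi * ξ * I) y) =
      perronDamping T ξ * (x : ℂ) ^ (2 * Real.pi * ξ * I) * smoothZetaC ((α : ℂ) + 2 * Real.pi * ξ * I) y by ring]
    exact hL2
  have hright : ∫ ξ : ℝ, ∑' n : ℕ, F n ξ = ∫ ξ : ℝ, perronDamping T ξ * ((x : ℂ) ^ (2 * Real.pi * ξ * I) *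
      smoothZetaC ((α : ℂ) + 2 * Real.pi * ξ * I) y) :=
    integral_congr_ae (Eventually.of_forall fun ξ => (hpt ξ).tsum_eq)
  rw [hleft, hright] at hmain
  exact hmain

/-- **The Gaussian short-interval sum is bounded by a Gaussian mean of `|ζ(α + iτ, y)|`**:
`Σ_{n y-smooth} n^{-α} e^{-T²(log n - log x)²/8} ≤ (2√(2π)/T) ∫ e^{-8π²ξ²/T²} |ζ(α + 2πiξ, y)| dξ`
(`α, T, x > 0`). [cite: HildebrandTenenbaum1986, Lemma 9] -/
theorem tsum_indicator_exp_neg_le (hα : 0 < α) (hT : 0 < T) (hx : 0 < x) (y : ℕ) :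
    ∑' n : ℕ, (Nat.smoothNumbers (y + 1)).indicator
        (fun n : ℕ => (n : ℝ) ^ (-α) * Real.exp (-(T ^ 2 * (Real.log n - Real.log x) ^ 2 / 8))) n ≤
      2 * Real.sqrt (2 * Real.pi) / T *
        ∫ ξ : ℝ, ‖perronDamping (T / 2) ξ‖ * ‖smoothZetaC ((α : ℂ) + 2 * Real.pi * ξ * I) y‖ := by
  have hT2 : 0 < T / 2 := half_pos hT
  have h := hasSum_indicator_perronGauss hα hT2 hx y
  have hre := Complex.hasSum_re h
  simp only [Complex.ofReal_re] at hre
  set c : ℝ := 2 * Real.sqrt (2 * Real.pi) / T with hc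
  have hc0 : 0 ≤ c := by positivity
  -- the summand is `c` times the `k_{T/2}` summand
  have hterm : (fun n : ℕ => (Nat.smoothNumbers (y + 1)).indicator
      (fun n : ℕ => (n : ℝ) ^ (-α) * Real.exp (-(T ^ 2 * (Real.log n - Real.log x) ^ 2 / 8))) n) =
        fun n : ℕ => c * (Nat.smoothNumbers (y + 1)).indicator
          (fun n : ℕ => (n : ℝ) ^ (-α) * perronGauss (T / 2) (Real.log n - Real.log x)) n := by
    funext n
    by_cases hn : n ∈ Nat.smoothNumbers (y + 1)
    · rw [indicator_of_mem hn, indicator_of_mem hn, exp_neg_eq_mul_perronGauss_half hT]; ring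
    · rw [indicator_of_notMem hn, indicator_of_notMem hn, mul_zero]
  rw [hterm, tsum_mul_left, hre.tsum_eq]
  refine mul_le_mul_of_nonneg_left ?_ hc0
  refine (Complex.re_le_norm _).trans ((norm_integral_le_integral_norm _).trans (le_of_eq ?_))
  refine integral_congr_ae (Eventually.of_forall fun ξ => ?_)
  simp only [norm_mul]
  rw [Complex.norm_cpow_eq_rpow_re_of_pos hx]
  simp

/-- **Gaussian-smoothed Perron formula, integral form.** For `x ≥ 1`, `0 < α ≤ T/2` and every `y`,
`|x^{-α} Ψ(x, y) - e^{-α²/(2T²)} Re ∫ e^{-2π²ξ²/T²} x^{2πiξ} ζ(α + 2πiξ, y)/(α + 2πiξ) dξ|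
  ≤ (4√(2π)/T) ∫ e^{-8π²ξ²/T²} |ζ(α + 2πiξ, y)| dξ`
(`card_smooth_gaussPerron` and `tsum_indicator_exp_neg_le`): the counting function of the `y`-smooth numbers is
determined, up to a Gaussian mean of `|ζ(α + iτ, y)|` at width `T`, by `ζ(s, y)` on the segment-with-Gaussian-weight
`Re s = α`, `|Im s| ≲ T` — no information at height `≫ T` is needed. [cite: HildebrandTenenbaum1986, §4, Lemmas 9–10] -/
theorem card_smooth_gaussPerron_integral (hx : 1 ≤ x) (hα : 0 < α) (hT : 0 < T) (hαT : α ≤ T / 2) (y : ℕ) :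
    |x ^ (-α) * ((Nat.smoothNumbersUpTo ⌊x⌋₊ (y + 1)).card : ℝ) -
        Real.exp (-(α ^ 2 / (2 * T ^ 2))) * (∫ ξ : ℝ, perronDamping T ξ * ((x : ℂ) ^ (2 * Real.pi * ξ * I) *
          smoothZetaC ((α : ℂ) + 2 * Real.pi * ξ * I) y / ((α : ℂ) + 2 * Real.pi * ξ * I))).re| ≤
      4 * Real.sqrt (2 * Real.pi) / T *
        ∫ ξ : ℝ, ‖perronDamping (T / 2) ξ‖ * ‖smoothZetaC ((α : ℂ) + 2 * Real.pi * ξ * I) y‖ := by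
  have hx0 : 0 < x := by linarith
  have h1 := card_smooth_gaussPerron hx hα hT hαT y
  have h2 := tsum_indicator_exp_neg_le hα hT hx0 y
  have : 2 * (2 * Real.sqrt (2 * Real.pi) / T *
      ∫ ξ : ℝ, ‖perronDamping (T / 2) ξ‖ * ‖smoothZetaC ((α : ℂ) + 2 * Real.pi * ξ * I) y‖) =
        4 * Real.sqrt (2 * Real.pi) / T *
          ∫ ξ : ℝ, ‖perronDamping (T / 2) ξ‖ * ‖smoothZetaC ((α : ℂ) + 2 * Real.pi * ξ * I) y‖ := by ring
  linarith

end GaussPerron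

end Literature.NumberTheory.Sieve

end
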